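import Summits.Ventures.LatticeQCDFlow.Scoring.SU2PlaquetteCharacterSeries
import Summits.Ventures.LatticeQCDFlow.Scoring.FinitePiSeriesProduct
import HarnessLib

/-!
# SU(2): the product of Wilson plaquette weights as ONE absolutely convergent multi-series, and its term-by-term integration (Fubini for the character expansion)

HONEST FRAMING: exact (Metropolis-corrected) sampling algorithms for lattice gauge theory;
figures of merit are autocorrelation/cost numbers at stated couplings and volumes; no
continuum-physics claim.

Venture `LatticeQCDFlow` (cell pub-lqcd), sub-topic `Scoring`; FANOUT row 5 (`s0-sun-a`), GEN-9.
NEW WORK of the cell (placement rule).  Step 6a of row 5's route to the exact SU(2) torus formula —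
the analytic half of the lattice assembly, stated ABSTRACTLY (any probability space `Ω`, any finite
family of `[−1,1]`-valued measurable "plaquette traces" `a_p`), so that it applies verbatim to
`Ω = G^E` with `a_p = a₀ ∘ (plaquette holonomy)`:

* §1 **`hasSum_charCoeff_mul_chebyshevU_all`** — the character series
  `Σ_n c_n(β) U_n(t) = e^{−β(2−2t)}` holds for EVERY `t ∈ [−1, 1]` (`β ≥ 0`), the endpoints by
  continuity (uniform convergence from `Σ (n+1)c_n < ∞`), not only Haar-a.e.
* §2 **`prod_plaqWeight_eq_tsum`** — pointwise,
  `∏_p e^{−β(2−2a_p)} = Σ'_{x : Fin F → ℕ} ∏_p c_{x_p} U_{x_p}(a_p)` (`FinitePiSeriesProduct`).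
* §3 **`integral_prod_plaqWeight_eq_tsum`** — for measurable `a : Fin F → Ω → [−1,1]` on a probability
  space: `∫ ∏_p e^{−β(2−2a_p(ω))} dμ = Σ'_x (∏_p c_{x_p}) · ∫ ∏_p U_{x_p}(a_p(ω)) dμ`, the series
  converging absolutely (domination `Σ_x ∏_p (x_p+1)c_{x_p} = (Σ_n (n+1)c_n)^F`).

What then remains of step 6 is purely group-theoretic/combinatorial: evaluating
`∫_{G^E} ∏_p U_{x_p}(a₀(U_∂p)) dHaar^E` by face merging (`integral_su2Character_mul_conv`) and the
handle identity (`integral_su2Character_handle`).  No new definition; nothing cited.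
-/

noncomputable section

open Real MeasureTheory Set Filter Topology Finset Polynomial.Chebyshev
open Literature.MathematicalPhysics.QuantumFieldTheory Literature.MathematicalPhysics.QuantumLattice
open Literature.Analysis.FunctionSpaces
open Summit.Ventures.LatticeQCDFlow.Exactness

namespace Summit.Ventures.LatticeQCDFlow.Scoring

/-! ## §1. The character series at every point of `[−1, 1]` -/

/-- The character series in the variable `t = cos α`, `sin α ≠ 0`:
`Σ_n c_n(β) U_n(t) = e^{−β(2−2t)}` for `|t| < 1`. -/
theorem hasSum_charCoeff_mul_chebyshevU_of_abs_lt (β : ℝ) {t : ℝ} (ht : |t| < 1) :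
    HasSum (fun n : ℕ => Real.exp (-(2 * β)) * (besselI n (2 * β) - besselI (n + 2) (2 * β)) *
        (U ℝ n).eval t) (Real.exp (-(β * (2 - 2 * t)))) := by
  have hlt := abs_lt.mp ht
  have hcos : Real.cos (Real.arccos t) = t := Real.cos_arccos hlt.1.le hlt.2.le
  have hsin : Real.sin (Real.arccos t) ≠ 0 := by
    rw [Real.sin_arccos]
    exact (Real.sqrt_pos.mpr (by nlinarith [hlt.1, hlt.2])).ne'
  have h := (hasSum_besselI_sub_mul_chebyshevU (2 * β) hsin).mul_left (Real.exp (-(2 * β)))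
  rw [hcos] at h
  have e : Real.exp (-(2 * β)) * Real.exp (2 * β * t) = Real.exp (-(β * (2 - 2 * t))) := by
    rw [← Real.exp_add]; ring_nf
  rw [e] at h
  refine h.congr_fun fun n => ?_
  ring

/-- The partial character series is dominated on `[−1, 1]` by the summable `(n+1)·e^{−2β}I_n(2β)`. -/
theorem norm_charCoeff_mul_chebyshevU_le {β : ℝ} (hβ : 0 ≤ β) (n : ℕ) {t : ℝ} (ht : t ∈ Icc (-1 : ℝ) 1) :
    ‖Real.exp (-(2 * β)) * (besselI n (2 * β) - besselI (n + 2) (2 * β)) * (U ℝ n).eval t‖ ≤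
      ((n : ℝ) + 1) * (Real.exp (-(2 * β)) * besselI n (2 * β)) := by
  rw [Real.norm_eq_abs, abs_mul, abs_of_nonneg (charCoeff_nonneg hβ n), mul_comm]
  exact mul_le_mul (abs_chebyshevU_eval_le n (abs_le.mpr ht)) (charCoeff_le hβ n)
    (charCoeff_nonneg hβ n) (by positivity)

/-- **The character series of the Wilson weight holds at EVERY `t ∈ [−1, 1]`** (`β ≥ 0`):
`Σ_n e^{−2β}(I_n(2β) − I_{n+2}(2β))·U_n(t) = e^{−β(2−2t)}` — the endpoints `t = ±1` by continuity. -/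
theorem hasSum_charCoeff_mul_chebyshevU_all {β : ℝ} (hβ : 0 ≤ β) {t : ℝ} (ht : t ∈ Icc (-1 : ℝ) 1) :
    HasSum (fun n : ℕ => Real.exp (-(2 * β)) * (besselI n (2 * β) - besselI (n + 2) (2 * β)) *
        (U ℝ n).eval t) (Real.exp (-(β * (2 - 2 * t)))) := by
  set c : ℕ → ℝ := fun n => Real.exp (-(2 * β)) * (besselI n (2 * β) - besselI (n + 2) (2 * β)) with hc
  -- the sum is continuous on [−1, 1] (uniform convergence), and so is the exponential
  have hS : ContinuousOn (fun s : ℝ => ∑' n : ℕ, c n * (U ℝ n).eval s) (Icc (-1 : ℝ) 1) := by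
    refine continuousOn_tsum (fun n => ?_) (summable_succ_mul_exp_mul_besselI hβ)
      (fun n s hs => norm_charCoeff_mul_chebyshevU_le hβ n hs)
    exact (continuous_const.mul (U ℝ n).continuous).continuousOn
  have hE : ContinuousOn (fun s : ℝ => Real.exp (-(β * (2 - 2 * s)))) (Icc (-1 : ℝ) 1) := by
    refine Continuous.continuousOn ?_; fun_prop
  have hIoo : EqOn (fun s : ℝ => ∑' n : ℕ, c n * (U ℝ n).eval s) (fun s => Real.exp (-(β * (2 - 2 * s))))
      (Ioo (-1 : ℝ) 1) := fun s hs =>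
    (hasSum_charCoeff_mul_chebyshevU_of_abs_lt β (abs_lt.mpr hs)).tsum_eq
  have hIcc : EqOn (fun s : ℝ => ∑' n : ℕ, c n * (U ℝ n).eval s) (fun s => Real.exp (-(β * (2 - 2 * s))))
      (Icc (-1 : ℝ) 1) :=
    hIoo.of_subset_closure hS hE Ioo_subset_Icc_self (by rw [closure_Ioo (by norm_num)])
  have hsum : Summable fun n : ℕ => c n * (U ℝ n).eval t :=
    Summable.of_norm_bounded (summable_succ_mul_exp_mul_besselI hβ)
      (fun n => norm_charCoeff_mul_chebyshevU_le hβ n ht)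
  exact hsum.hasSum_iff.mpr (hIcc ht)

/-- On SU(2): the character series of the plaquette weight holds for EVERY `U` (`β ≥ 0`). -/
theorem hasSum_charCoeff_mul_chebyshevU' {β : ℝ} (hβ : 0 ≤ β) (V : Matrix.specialUnitaryGroup (Fin 2) ℂ) :
    HasSum (fun n : ℕ => Real.exp (-(2 * β)) * (besselI n (2 * β) - besselI (n + 2) (2 * β)) *
        (U ℝ n).eval (su2a0 V)) (Real.exp (-(β * (2 - 2 * su2a0 V)))) :=
  hasSum_charCoeff_mul_chebyshevU_all hβ (abs_le.mp (abs_su2a0_le_one V))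

/-! ## §2. The product of plaquette weights as one multi-series -/

/-- **Pointwise product expansion**: for `t : Fin F → [−1, 1]` and `β ≥ 0`,
`∏_p e^{−β(2−2t_p)} = Σ'_{x : Fin F → ℕ} ∏_p c_{x_p}(β) U_{x_p}(t_p)`, and the multi-series is
absolutely summable. -/
theorem prod_plaqWeight_eq_tsum {β : ℝ} (hβ : 0 ≤ β) {F : ℕ} (t : Fin F → ℝ)
    (ht : ∀ p, t p ∈ Icc (-1 : ℝ) 1) :
    (Summable fun x : Fin F → ℕ => ‖∏ p, (Real.exp (-(2 * β)) *
        (besselI (x p) (2 * β) - besselI (x p + 2) (2 * β)) * (U ℝ (x p)).eval (t p))‖) ∧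
      ∏ p, Real.exp (-(β * (2 - 2 * t p))) =
        ∑' x : Fin F → ℕ, ∏ p, (Real.exp (-(2 * β)) *
          (besselI (x p) (2 * β) - besselI (x p + 2) (2 * β)) * (U ℝ (x p)).eval (t p)) := by
  have h := summable_norm_prod_pi_and_tsum F
    (fun p n => Real.exp (-(2 * β)) * (besselI n (2 * β) - besselI (n + 2) (2 * β)) * (U ℝ n).eval (t p))
    (fun p => Summable.of_nonneg_of_le (fun n => norm_nonneg _)
      (fun n => norm_charCoeff_mul_chebyshevU_le hβ n (ht p)) (summable_succ_mul_exp_mul_besselI hβ))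
  refine ⟨h.1, ?_⟩
  rw [h.2]
  exact Finset.prod_congr rfl fun p _ => ((hasSum_charCoeff_mul_chebyshevU_all hβ (ht p)).tsum_eq).symm

/-! ## §3. Term-by-term integration -/

/-- **Fubini for the character expansion.**  On a probability space, for measurable
`a : Fin F → Ω → ℝ` with values in `[−1, 1]` and `β ≥ 0`:
`∫ ∏_p e^{−β(2−2a_p)} dμ = Σ'_{x : Fin F → ℕ} (∏_p c_{x_p}(β)) · ∫ ∏_p U_{x_p}(a_p) dμ`,
and the series on the right converges absolutely. -/
theorem integral_prod_plaqWeight_eq_tsum {Ω : Type*} [MeasurableSpace Ω] (μ : Measure Ω)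
    [IsProbabilityMeasure μ] {β : ℝ} (hβ : 0 ≤ β) {F : ℕ} (a : Fin F → Ω → ℝ)
    (ham : ∀ p, Measurable (a p)) (ha : ∀ p ω, a p ω ∈ Icc (-1 : ℝ) 1) :
    (Summable fun x : Fin F → ℕ => (∏ p, Real.exp (-(2 * β)) *
        (besselI (x p) (2 * β) - besselI (x p + 2) (2 * β))) *
        ∫ ω, ∏ p, (U ℝ (x p)).eval (a p ω) ∂μ) ∧
    ∫ ω, ∏ p, Real.exp (-(β * (2 - 2 * a p ω))) ∂μ =
      ∑' x : Fin F → ℕ, (∏ p, Real.exp (-(2 * β)) *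
        (besselI (x p) (2 * β) - besselI (x p + 2) (2 * β))) *
        ∫ ω, ∏ p, (U ℝ (x p)).eval (a p ω) ∂μ := by
  set c : ℕ → ℝ := fun n => Real.exp (-(2 * β)) * (besselI n (2 * β) - besselI (n + 2) (2 * β)) with hc
  set d : ℕ → ℝ := fun n => ((n : ℝ) + 1) * (Real.exp (-(2 * β)) * besselI n (2 * β)) with hd
  -- the terms G x ω = ∏_p c_{x_p} U_{x_p}(a_p ω), bounded by D x = ∏_p d_{x_p}
  have hGm : ∀ x : Fin F → ℕ, Measurable fun ω => ∏ p, c (x p) * (U ℝ (x p)).eval (a p ω) := by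
    intro x
    refine Finset.measurable_prod _ fun p _ => ?_
    exact measurable_const.mul ((U ℝ (x p)).continuous.measurable.comp (ham p))
  have hGb : ∀ (x : Fin F → ℕ) (ω : Ω), ‖∏ p, c (x p) * (U ℝ (x p)).eval (a p ω)‖ ≤ ∏ p, d (x p) := by
    intro x ω
    rw [norm_prod]
    exact Finset.prod_le_prod (fun p _ => norm_nonneg _)
      fun p _ => norm_charCoeff_mul_chebyshevU_le hβ (x p) (ha p ω)
  have hDs : Summable fun x : Fin F → ℕ => ∏ p, d (x p) :=
    (tsum_prod_pi_eq_prod_tsum_of_nonneg (fun _ : Fin F => d)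
      (fun _ n => by have := besselI_nonneg n (show 0 ≤ 2 * β by linarith); positivity)
      (fun _ => summable_succ_mul_exp_mul_besselI hβ)).1
  have hGi : ∀ x : Fin F → ℕ, Integrable (fun ω => ∏ p, c (x p) * (U ℝ (x p)).eval (a p ω)) μ :=
    fun x => Integrable.mono' (integrable_const (∏ p, d (x p))) (hGm x).aestronglyMeasurable
      (Eventually.of_forall (hGb x))
  have hnorm : Summable fun x : Fin F → ℕ => ∫ ω, ‖∏ p, c (x p) * (U ℝ (x p)).eval (a p ω)‖ ∂μ := by
    refine Summable.of_nonneg_of_le (fun x => integral_nonneg fun ω => norm_nonneg _) (fun x => ?_) hDs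
    calc ∫ ω, ‖∏ p, c (x p) * (U ℝ (x p)).eval (a p ω)‖ ∂μ ≤ ∫ _ω, ∏ p, d (x p) ∂μ :=
          integral_mono_of_nonneg (Eventually.of_forall fun ω => norm_nonneg _) (integrable_const _)
            (Eventually.of_forall (hGb x))
      _ = ∏ p, d (x p) := by rw [MeasureTheory.integral_const, probReal_univ, one_smul]
  -- pointwise expansion, then exchange ∫ and Σ'
  have hpt : ∀ ω, ∏ p, Real.exp (-(β * (2 - 2 * a p ω))) =
      ∑' x : Fin F → ℕ, ∏ p, c (x p) * (U ℝ (x p)).eval (a p ω) :=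
    fun ω => (prod_plaqWeight_eq_tsum hβ (fun p => a p ω) (fun p => ha p ω)).2
  have hswap := integral_tsum_of_summable_integral_norm hGi hnorm
  -- the constants come out of each integral
  have hterm : ∀ x : Fin F → ℕ, ∫ ω, ∏ p, c (x p) * (U ℝ (x p)).eval (a p ω) ∂μ =
      (∏ p, c (x p)) * ∫ ω, ∏ p, (U ℝ (x p)).eval (a p ω) ∂μ := by
    intro x
    rw [← MeasureTheory.integral_const_mul]
    refine integral_congr_ae (Eventually.of_forall fun ω => ?_)
    simp only [Finset.prod_mul_distrib]
  simp_rw [hpt, ← hswap, hterm]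
  refine ⟨?_, rfl⟩
  -- absolute convergence of the coefficient series: |∏ c · ∫ ∏ U| ≤ ∏ d
  refine Summable.of_norm_bounded hDs fun x => ?_
  rw [← hterm]
  exact (norm_integral_le_integral_norm _).trans
    ((integral_mono_of_nonneg (Eventually.of_forall fun ω => norm_nonneg _) (integrable_const _)
      (Eventually.of_forall (hGb x))).trans_eq
      (by rw [MeasureTheory.integral_const, probReal_univ, one_smul]))

end Summit.Ventures.LatticeQCDFlow.Scoring
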